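import Summits.QuantumFields.BalabanUV.Beta.GAN24.DerivativeRateTransferLoewnerKKT

/-!
# `BalabanUV.Beta.GAN24.DerivativeRateTransferLoewnerGramConvergeSharp` — binder row G-an2-4 ∕ (CONV-C), route R6 «VALUES, NOT DERIVATIVES», PART 104:
# THE RATE IS NOT FREE — a kernel-checked tower satisfying EVERY hypothesis of PART 18's exact END except (CONS) (PSD forms, nonsingular bordered matrices,
# `Qc (j+1) = Qc j·Qf j`, exact (STAB), k-uniform `hB`) whose effective forms converge (PARTs 99 ∕ 103 apply) but admit NO geometric one-step rate
# (unit b2b-balaban-gan24-p3, gen 48; v1 — the tightness twin of PARTs 99 ∕ 103)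

NOT IN PRINT; OUR PROOF ([folklore]: the tower `H_j = (1 − 1∕(j+2))·1` with identity averagings; `𝒮_j = H_j` (`effForm H 1 = H`), increments `1∕((j+2)(j+3))`, and
`n²θⁿ → 0` for `|θ| < 1` — Mathlib `tendsto_pow_const_mul_const_pow_of_abs_lt_one`).  HONEST FRAMING (cell contract, verbatim): «discharging `BetaPertH` makes Bałaban's
UV stability UNCONDITIONAL — a real constructive-QFT result; it is NOT the continuum limit and NOT the Clay problem.»  HONEST DEPENDENCY (verbatim): «continuum YM on T⁴ ⇐
BetaPertH ∧ nine spine estimates (0/9 proved); BetaPertH ⇐ (D1) ∧ (D4) ∧ CAP+tail; G-an2-4 gates asym, D1 and NE2/3/4.»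

WHY THIS FILE.  PARTs 99 ∕ 100 ∕ 101 ∕ 103 show that WITHOUT (CONS) the effective-form tower still converges, with bounded variation.  This file certifies that
the missing RATE is not an artefact of the proofs: on the one-site-per-level tower `ι j = c`, `Qc j = Qf j = 1`, `H_j = (1 − 1∕(j+2))•1` every structural
hypothesis of PART 18's `effForm_entry_step_rate_of_stab_of_cons` holds (PSD, nonsingular bordered matrices, composition, EXACT (STAB) `1ᵀH_j1 ≤ H_{j+1}`), the
effective forms are `𝒮_j = H_j` with the k-uniform bound `𝒮_j(a,a) ≤ 1`, and the increments are EXACTLY `1∕((j+2)(j+3))` — summable (total variation `½`), but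
not `≤ C·θ^j` for any `C` and any `0 ≤ θ < 1`.  So in the route's ENDs the consistency datum (CONS) (or an equivalent rate input) is NECESSARY for
(CONV-C)'s geometric rate, not only sufficient; the ledger reading «(CONS) buys the rate, not the limit» is two-sided.

WHAT THIS FILE PROVES (0 sorry, 0 `def`, nothing cited): `kkt_one_leftInverse` (`[[0,1],[1,−H]]·[[H,1],[1,0]] = 1`), `isUnit_kkt_one_det`, **`effForm_one`**
(`effForm H 1 = H`), `sharpTower_posSemidef` ∕ `sharpTower_stab` ∕ `sharpTower_effForm_diag` ∕ `sharpTower_step` (the tower's hypotheses and its exact increments),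
**`sharpTower_no_geometric_rate`** (`¬ ∃ C θ, 0 ≤ θ < 1 ∧ ∀ j a, |𝒮_{j+1}(a,a) − 𝒮_j(a,a)| ≤ C·θ^j`), and `unboundedTower_not_convergent` (`H_j = j•1`: exact
(STAB) without a bounded diagonal, `𝒮_j(a,a) = j` does not converge — PART 99's `hB` is not free either).
WHAT IT DOES NOT DO: say anything about Bałaban's tower (where (CONS) is expected to HOLD with `θ = L⁻²`); it is a tightness statement about the END's hypothesis
list.  SUPPLIER work on route C-R6° (rank 2, REDUCTION); no consumer of record; NEVER «G-an2-4 closed»; NOT (CONV-C), NOT D1, NOT `BetaPertH`, NOT continuum, NOT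
Clay.  Records: `HOME/b2b-balaban-gan24-p3/gen48/R6-LEDGER-NOTE.md`, `…/gen48/README.md`.
-/

noncomputable section

open Set Matrix Finset Filter Topology

namespace Summit.QuantumFields.BalabanUV.Beta.GAN24.DerivativeRateTransferLoewnerGramConvergeSharp

open Literature.MathematicalPhysics.QuantumFieldTheory.Balaban1983to89.Beta.Composition (kkt)
open Literature.MathematicalPhysics.QuantumFieldTheory.Balaban1983to89.Beta.CompositionSingular (effForm kkt_eq_fromBlocks)

/-! ## §1 The identity constraint: `effForm H 1 = H` -/

section Identity

variable {ν : Type*} [Fintype ν] [DecidableEq ν]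

/-- the explicit inverse of the bordered matrix of the identity constraint: `[[0,1],[1,−H]]·[[H,1],[1,0]] = 1`. [folklore] -/
theorem kkt_one_leftInverse (H : Matrix ν ν ℝ) :
    fromBlocks (0 : Matrix ν ν ℝ) 1 1 (-H) * kkt H (1 : Matrix ν ν ℝ) = 1 := by
  rw [kkt_eq_fromBlocks, fromBlocks_multiply, transpose_one]
  simp only [Matrix.zero_mul, Matrix.one_mul, Matrix.mul_one, Matrix.mul_zero, zero_add, add_zero, add_neg_cancel]
  exact fromBlocks_one

/-- the bordered matrix of the identity constraint is nonsingular. [folklore] -/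
theorem isUnit_kkt_one_det (H : Matrix ν ν ℝ) : IsUnit (kkt H (1 : Matrix ν ν ℝ)).det :=
  Matrix.isUnit_det_of_left_inverse (kkt_one_leftInverse H)

/-- **`effForm_one` — THE EFFECTIVE FORM OF THE IDENTITY CONSTRAINT IS THE FORM ITSELF**: `effForm H 1 = H` (no fluctuation directions). [folklore] -/
theorem effForm_one (H : Matrix ν ν ℝ) : effForm H (1 : Matrix ν ν ℝ) = H := by
  rw [effForm, Matrix.inv_eq_left_inv (kkt_one_leftInverse H), toBlocks_fromBlocks₂₂, neg_neg]

end Identity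

/-! ## §2 The sharp tower `H_j = (1 − 1∕(j+2))•1`, identity averagings -/

section Sharp

variable {c : Type*} [Fintype c] [DecidableEq c]

/-- the level coefficient `1 − 1∕(j+2) ∈ [0,1)`. [folklore] -/
theorem coeff_nonneg (j : ℕ) : 0 ≤ 1 - 1 / ((j : ℝ) + 2) := by
  have hj : (2 : ℝ) ≤ (j : ℝ) + 2 := by have := (Nat.cast_nonneg j : (0 : ℝ) ≤ j); linarith
  rw [sub_nonneg, div_le_one (by linarith)]; linarith

/-- the increment of the coefficients: `(1 − 1∕(j+3)) − (1 − 1∕(j+2)) = 1∕((j+2)(j+3))`. [folklore] -/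
theorem coeff_step (j : ℕ) :
    (1 - 1 / (((j + 1 : ℕ) : ℝ) + 2)) - (1 - 1 / ((j : ℝ) + 2)) = 1 / (((j : ℝ) + 2) * ((j : ℝ) + 3)) := by
  have h2 : (j : ℝ) + 2 ≠ 0 := by have := (Nat.cast_nonneg j : (0 : ℝ) ≤ j); linarith
  have h3 : (j : ℝ) + 3 ≠ 0 := by have := (Nat.cast_nonneg j : (0 : ℝ) ≤ j); linarith
  push_cast
  field_simp
  ring

omit [Fintype c] in
/-- the sharp tower's forms are PSD. [folklore] -/
theorem sharpTower_posSemidef (j : ℕ) : ((1 - 1 / ((j : ℝ) + 2)) • (1 : Matrix c c ℝ)).PosSemidef :=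
  Matrix.PosSemidef.one.smul (coeff_nonneg j)

/-- the sharp tower satisfies EXACT (STAB) for the identity averaging: `0 ≤ H_{j+1} − 1ᵀH_j1`. [folklore] -/
theorem sharpTower_stab (j : ℕ) :
    ((1 - 1 / ((((j + 1 : ℕ) : ℝ)) + 2)) • (1 : Matrix c c ℝ) -
      (1 : Matrix c c ℝ)ᵀ * ((1 - 1 / ((j : ℝ) + 2)) • (1 : Matrix c c ℝ)) * 1).PosSemidef := by
  rw [transpose_one, Matrix.one_mul, Matrix.mul_one, ← sub_smul, coeff_step]
  exact Matrix.PosSemidef.one.smul (by positivity)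

/-- the sharp tower's effective forms: `𝒮_j = H_j`, diagonal `1 − 1∕(j+2) ≤ 1`. [folklore] -/
theorem sharpTower_effForm_diag (j : ℕ) (a : c) :
    effForm ((1 - 1 / ((j : ℝ) + 2)) • (1 : Matrix c c ℝ)) 1 a a = 1 - 1 / ((j : ℝ) + 2) := by
  rw [effForm_one, Matrix.smul_apply, Matrix.one_apply_eq, smul_eq_mul, mul_one]

/-- the k-uniform bound `hB` with `B = 1`. [folklore] -/
theorem sharpTower_effForm_diag_le (j : ℕ) (a : c) : effForm ((1 - 1 / ((j : ℝ) + 2)) • (1 : Matrix c c ℝ)) 1 a a ≤ 1 := by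
  rw [sharpTower_effForm_diag]
  have : 0 ≤ 1 / ((j : ℝ) + 2) := by positivity
  linarith

/-- the exact increments `𝒮_{j+1}(a,a) − 𝒮_j(a,a) = 1∕((j+2)(j+3))`. [folklore] -/
theorem sharpTower_step (j : ℕ) (a : c) :
    effForm ((1 - 1 / (((j + 1 : ℕ) : ℝ) + 2)) • (1 : Matrix c c ℝ)) 1 a a - effForm ((1 - 1 / ((j : ℝ) + 2)) • (1 : Matrix c c ℝ)) 1 a a =
      1 / (((j : ℝ) + 2) * ((j : ℝ) + 3)) := by
  rw [sharpTower_effForm_diag, sharpTower_effForm_diag, coeff_step]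

/-- **`sharpTower_no_geometric_rate` — THE RATE IS NOT FREE** [our proof]: for the tower `H_j = (1 − 1∕(j+2))•1` with identity averagings (all of PART 18's
structural hypotheses, EXACT (STAB), `hB` with `B = 1` — `sharpTower_posSemidef`, `isUnit_kkt_one_det`, `sharpTower_stab`, `sharpTower_effForm_diag_le`) there are
NO `C` and `0 ≤ θ < 1` with `|𝒮_{j+1}(a,a) − 𝒮_j(a,a)| ≤ C·θ^j` for all `j` (`c` inhabited). -/
theorem sharpTower_no_geometric_rate [Nonempty c] :
    ¬ ∃ C θ : ℝ, 0 ≤ θ ∧ θ < 1 ∧ ∀ (j : ℕ) (a : c),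
      |effForm ((1 - 1 / (((j + 1 : ℕ) : ℝ) + 2)) • (1 : Matrix c c ℝ)) 1 a a - effForm ((1 - 1 / ((j : ℝ) + 2)) • (1 : Matrix c c ℝ)) 1 a a| ≤
        C * θ ^ j := by
  rintro ⟨C, θ, hθ0, hθ1, h⟩
  obtain ⟨a⟩ := ‹Nonempty c›
  have hstep : ∀ j : ℕ, 1 / (((j : ℝ) + 2) * ((j : ℝ) + 3)) ≤ C * θ ^ j := fun j => by
    have := h j a
    rwa [sharpTower_step, abs_of_nonneg (by positivity)] at this
  -- `C > 0`
  have hC : 0 < C := by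
    have h0 := hstep 0
    rw [pow_zero, mul_one] at h0
    have h6 : (0 : ℝ) < 1 / ((((0 : ℕ) : ℝ) + 2) * (((0 : ℕ) : ℝ) + 3)) := by positivity
    linarith
  -- `n² θⁿ → 0`, hence eventually `12·C·n²·θⁿ < 1`
  have hlim := tendsto_pow_const_mul_const_pow_of_abs_lt_one 2 (show |θ| < 1 by rwa [abs_of_nonneg hθ0])
  have hev : ∀ᶠ n : ℕ in atTop, (n : ℝ) ^ 2 * θ ^ n < 1 / (12 * C) :=
    (tendsto_order.1 hlim).2 _ (by positivity)
  obtain ⟨n, hn, hn1⟩ := (hev.and (eventually_ge_atTop 1)).exists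
  have hn1' : (1 : ℝ) ≤ n := by exact_mod_cast hn1
  have hθn : 0 ≤ θ ^ n := pow_nonneg hθ0 n
  -- `(n+2)(n+3) ≤ 12 n²` for `n ≥ 1`
  have hpoly : ((n : ℝ) + 2) * ((n : ℝ) + 3) ≤ 12 * (n : ℝ) ^ 2 := by nlinarith
  have hpos : 0 < ((n : ℝ) + 2) * ((n : ℝ) + 3) := by positivity
  -- from the step bound: `1 ≤ C θⁿ (n+2)(n+3) ≤ 12 C n² θⁿ < 1`
  have h1 : 1 ≤ C * θ ^ n * (((n : ℝ) + 2) * ((n : ℝ) + 3)) := by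
    have := hstep n
    rw [div_le_iff₀ hpos] at this
    linarith
  have h2 : C * θ ^ n * (((n : ℝ) + 2) * ((n : ℝ) + 3)) ≤ 12 * C * ((n : ℝ) ^ 2 * θ ^ n) := by
    have := mul_le_mul_of_nonneg_left hpoly (mul_nonneg hC.le hθn)
    linarith
  have h3 : 12 * C * ((n : ℝ) ^ 2 * θ ^ n) < 12 * C * (1 / (12 * C)) := mul_lt_mul_of_pos_left hn (by positivity)
  have h4 : 12 * C * (1 / (12 * C)) = 1 := by field_simp
  linarith

/-- **`unboundedTower_not_convergent` — AND THE BOUNDED DIAGONAL IS NOT FREE EITHER** [our proof]: the tower `H_j = j•1` with identity averagings satisfies the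
structural hypotheses and EXACT (STAB) (`j ≤ j+1`), but its effective forms `𝒮_j(a,a) = j` do not converge — PART 99's bounded-diagonal hypothesis cannot be
dropped. -/
theorem unboundedTower_not_convergent (a : c) :
    (∀ j : ℕ, (((j : ℝ)) • (1 : Matrix c c ℝ)).PosSemidef) ∧
    (∀ j : ℕ, ((((j + 1 : ℕ) : ℝ)) • (1 : Matrix c c ℝ) - (1 : Matrix c c ℝ)ᵀ * (((j : ℝ)) • (1 : Matrix c c ℝ)) * 1).PosSemidef) ∧
    ¬ ∃ l : ℝ, Tendsto (fun j : ℕ => effForm (((j : ℝ)) • (1 : Matrix c c ℝ)) 1 a a) atTop (𝓝 l) := by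
  refine ⟨fun j => Matrix.PosSemidef.one.smul (Nat.cast_nonneg j), fun j => ?_, ?_⟩
  · rw [transpose_one, Matrix.one_mul, Matrix.mul_one, ← sub_smul]
    exact Matrix.PosSemidef.one.smul (by push_cast; linarith)
  · rintro ⟨l, hl⟩
    have he : (fun j : ℕ => effForm (((j : ℝ)) • (1 : Matrix c c ℝ)) 1 a a) = fun j : ℕ => (j : ℝ) := by
      funext j; rw [effForm_one, Matrix.smul_apply, Matrix.one_apply_eq, smul_eq_mul, mul_one]
    rw [he] at hl
    exact not_tendsto_nhds_of_tendsto_atTop tendsto_natCast_atTop_atTop l hl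

end Sharp

end Summit.QuantumFields.BalabanUV.Beta.GAN24.DerivativeRateTransferLoewnerGramConvergeSharp

end
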